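/-
Origin: expansion seat `prover-pub-hodgecm-mc-binder-2-g11-0`, handover #42 2026-08-20T03:37Z md5 f0fb3edbb48c (CERTIFIED rc 0 / 0 warn / 222.8 s; imports #41 `LetterSection` + #34 `OmgInsTorus`; install after both; `letterChar` (THE character of ENGINE #41, chosen once), `continuous_letterChar`, `cmArchWeilRep_letterSection_follandFock` (place-block form), `cmArchWeilRep_letterSection_follandFock_one` (pinned by the vacuum), **`cmPairRepTwist_letterSection_ins_tprod`** (`ρ_η(archProdHom (letterSection h))(ins f (⊗ₜ m)) = (η · letterChar h) • E(follandFock 𝔢 (∏_w placePoly m w ∘ letter_w†) ⊗ f)`), **`cmPairRepTwist_letterSection_ins_tprod_of_eigen`** (per-place letter eigen-equations with eigenvalues `d w` ⇒ the inserted pure tensor is an eigenvector of ALL the letters with eigenvalue `η(…) · letterChar h · ∏_w d w`) — the (J-x₀) analogue of #34 §3, i.e. with #40 the field `ins_mem` is reduced to (c) lettering K_∞, (d) the per-place V-letter eigen lemmas, (e) ONE character identity; NAME LIST `HodgeCM.Model.HypCensus.letterChar`, `HodgeCM.Model.HypCensus.cmPairRepTwist_letterSection_ins_tprod_of_eigen`,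 `HodgeCM.Model.HypCensus.cmArchWeilRep_letterSection_follandFock_one`; axioms trio) (`HOME/mc/pub-hodgecm-mc-binder-2/g11/pkg/HodgeCM/Model/HypCensus/LetterIns.lean`, md5 f0fb3edbb48c, 160 lines);
landed by the second packager p2 gen 2 (p2-g2) in gate run 40 as `HodgeCM/Model/HypCensus/LetterIns.lean` (verbatim).
-/
/-
Origin: speedrun cell pub-hodgecm, MODEL-CONSTRUCTION sub-cell, lineage mc-binder-2 (BINDER-OWNERS rows 18/19: E binders
`hyp12` / `hyp34` of `Model.perL_picardCM_r15A`), seat prover-pub-hodgecm-mc-binder-2-g11-0 (gen 11), 2026-08-20.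
Target in PKG: `HodgeCM/Model/HypCensus/LetterIns.lean` (NEW additive leaf; imports this lineage's `HypCensus/LetterSection` (#41) and
`HypCensus/OmgInsTorus` (#34)).  KERNEL ONLY: 0 records, nothing cited as hypothesis, 0 `def … : Prop`; one def (a chosen character) + theorems.
-/
import Summits.HodgeConjecture.HodgeCM.Model.HypCensus.LetterSection
import Summits.HodgeConjecture.HodgeCM.Model.HypCensus.OmgInsTorus

/-!
# Census kit (rows A12/A34), junction (J-x₀): ALL compact letters on an inserted printed pure tensor

The (J-x₀) analogue of #34/#35: with `letterChar` = THE character of ENGINE #41 (chosen once, pinned by the vacuum),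

* `cmArchWeilRep_letterSection_follandFock` — `ω_∞(letterSection h)(follandFock 𝔢 G) = letterChar h • follandFock 𝔢 (G ∘ letters(h)†)`
  (place-block form), `cmArchWeilRep_letterSection_follandFock_one` (pinned by the vacuum);
* **`cmPairRepTwist_letterSection_ins_tprod`** — `ρ_η(letterSection h)(ins f (⊗ₜ m)) = (η · letterChar h) • E(follandFock 𝔢 (∏_w placePoly m w ∘ letter_w†) ⊗ f)`;
* **`cmPairRepTwist_letterSection_ins_tprod_of_eigen`** — if every place polynomial is an eigenvector of its letter (eigenvalue `d w`), the
  inserted pure tensor is an eigenvector of `ρ_η(letterSection h)` with eigenvalue `η(letterSection h) · letterChar h · ∏_w d w`.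

So `ins f φ ∈ W₀.SK` (#40 `wmInputCM₂g_mem_SK_iff_arch`) reduces to: lettering `frameG⁻¹ k frameG` (step (c)), the per-place V-letter
eigen lemmas (step (d), bridges to `PerL34/FockGroupInvariants`), and ONE character identity (step (e)).  Nothing here is a claim of PerL/QW8.
-/

set_option autoImplicit false

noncomputable section

open NumberField NumberField.InfinitePlace IsDedekindDomain
open scoped Matrix Kronecker Classical TensorProduct ComplexConjugate
open MvPolynomial
open Literature.NumberTheory.Automorphic Literature.NumberTheory.Automorphic.UnitaryGroup Literature.NumberTheory.Weil1964
open Literature.RepresentationTheory.HeisenbergGroup (polar symplecticGroup)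
open Literature.RepresentationTheory.KonnoKonno2007 Literature.RepresentationTheory.KonnoKonno2007.RealDualPair
open Literature.NumberTheory.GelbartRogawski1991 Literature.NumberTheory.GelbartRogawski1991.UnitaryDualPair
open Literature.RepresentationTheory (atPlace)
open Literature.Analysis.SegalBargmann
open HodgeCM.PerL34.Fock HodgeCM.PerL34.Fock.PrintDict

namespace HodgeCM.Model.HypCensus

section Letters

variable (L : Type) [Field L] [NumberField L] [IsCMField L]
variable (dV : Fin 3 → L) (hdV : ∀ i, IsCMField.complexConj L (dV i) = dV i) (hdV0 : ∀ i, dV i ≠ 0)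
variable (dW : Fin 2 → L) (hdW : ∀ i, IsCMField.complexConj L (dW i) = dW i) (hdW0 : ∀ i, dW i ≠ 0)
variable (hGR : (cmSplittingDatum L finProdFinEquiv dV hdV hdV0 dW hdW hdW0).CompatibleSplitting) (ι₁ : L →+* ℂ)
variable
  (h₁V : ∃ i₀ : Fin 3, (∀ i, i ≠ i₀ → 0 < (ι₁ (dV i)).re) ∨ ∀ i, i ≠ i₀ → (ι₁ (dV i)).re < 0)
  (h₁W : (∀ j, 0 < (ι₁ (dW j)).re) ∨ ∀ j, (ι₁ (dW j)).re < 0)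
  (hV : ∀ τ : L →+* ℂ, InfinitePlace.mk τ ≠ InfinitePlace.mk ι₁ → (∀ i, 0 < (τ (dV i)).re) ∨ ∀ i, (τ (dV i)).re < 0)
  (hW : ∀ τ : L →+* ℂ, InfinitePlace.mk τ ≠ InfinitePlace.mk ι₁ →
    (∃ j₀ : Fin 2, ∀ j, j ≠ j₀ → 0 < (τ (dW j)).re) ∨ ∀ j, (τ (dW j)).re < 0)

/-- **THE LETTER CHARACTER of the CM pin** (`Π_v DPK_v →* S¹`, chosen once; pinned by the vacuum). -/
def letterChar : (∀ v : {v : InfinitePlace ↥(maximalRealSubfield L) // v.IsReal},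
      DPK (PosIdx (cmXV L dV hdV ι₁ v)) (NegIdx (cmXV L dV hdV ι₁ v)) (PosIdx (cmXW L dV dW hdW ι₁ v)) (NegIdx (cmXW L dV dW hdW ι₁ v))) →*
    Circle :=
  (exists_character_letterSection L finProdFinEquiv dV hdV hdV0 dW hdW hdW0 hGR ι₁ h₁V h₁W hV hW).choose

/-- (Ported verbatim from the HodgeCMPerL package; no docstring in the source.) -/
theorem continuous_letterChar : Continuous (letterChar L dV hdV hdV0 dW hdW hdW0 hGR ι₁ h₁V h₁W hV hW) :=
  (exists_character_letterSection L finProdFinEquiv dV hdV hdV0 dW hdW hdW0 hGR ι₁ h₁V h₁W hV hW).choose_spec.1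

/-- **the defining equation of `letterChar`**, place-block form. -/
theorem cmArchWeilRep_letterSection_follandFock
    (h : ∀ v : {v : InfinitePlace ↥(maximalRealSubfield L) // v.IsReal},
      DPK (PosIdx (cmXV L dV hdV ι₁ v)) (NegIdx (cmXV L dV hdV ι₁ v)) (PosIdx (cmXW L dV dW hdW ι₁ v)) (NegIdx (cmXW L dV dW hdW ι₁ v)))
    (G : MvPolynomial (Fin 6 × {v : InfinitePlace ↥(maximalRealSubfield L) // v.IsReal}) ℂ) :
    cmArchWeilRep L finProdFinEquiv dV hdV hdV0 dW hdW hdW0 hGR (letterSection L dV hdV hdV0 dW hdW hdW0 ι₁ h)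
        (follandFock (cmBigFrame L finProdFinEquiv dV hdV hdV0 dW hdW hdW0 ι₁) G) =
      ((letterChar L dV hdV hdV0 dW hdW hdW0 hGR ι₁ h₁V h₁W hV hW h : Circle) : ℂ) •
        follandFock (cmBigFrame L finProdFinEquiv dV hdV hdV0 dW hdW hdW0 ι₁)
          (linSubst (star ((placeBlock fun v : {v : InfinitePlace ↥(maximalRealSubfield L) // v.IsReal} =>
              reindexUnitary (pairFrame (PosIdx (cmXV L dV hdV ι₁ v)) (NegIdx (cmXV L dV hdV ι₁ v))
                (PosIdx (cmXW L dV dW hdW ι₁ v)) (NegIdx (cmXW L dV dW hdW ι₁ v)) finProdFinEquiv (cmEpsV L dV hdV ι₁ v)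
                (cmEpsW L dV dW hdW ι₁ v)) (dualPairι (h v)) :
              Matrix.unitaryGroup _ ℂ) : Matrix _ _ ℂ)) G) := by
  have h' := (exists_character_letterSection L finProdFinEquiv dV hdV hdV0 dW hdW hdW0 hGR ι₁ h₁V h₁W hV hW).choose_spec.2 h G
  rw [cmLetterBlock_apply] at h'
  exact h'

/-- **`letterChar` is PINNED by the vacuum.** -/
theorem cmArchWeilRep_letterSection_follandFock_one
    (h : ∀ v : {v : InfinitePlace ↥(maximalRealSubfield L) // v.IsReal},
      DPK (PosIdx (cmXV L dV hdV ι₁ v)) (NegIdx (cmXV L dV hdV ι₁ v)) (PosIdx (cmXW L dV dW hdW ι₁ v)) (NegIdx (cmXW L dV dW hdW ι₁ v))) :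
    cmArchWeilRep L finProdFinEquiv dV hdV hdV0 dW hdW hdW0 hGR (letterSection L dV hdV hdV0 dW hdW hdW0 ι₁ h)
        (follandFock (cmBigFrame L finProdFinEquiv dV hdV hdV0 dW hdW hdW0 ι₁) 1) =
      ((letterChar L dV hdV hdV0 dW hdW hdW0 hGR ι₁ h₁V h₁W hV hW h : Circle) : ℂ) •
        follandFock (cmBigFrame L finProdFinEquiv dV hdV hdV0 dW hdW hdW0 ι₁) 1 := by
  rw [cmArchWeilRep_letterSection_follandFock, map_one]

variable (η : CMAdelic L dV × CMAdelic L dW →* ℂˣ)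
variable (datum : ∀ b : InfinitePlace L, PlaceDatum L dV hdV dW hdW ι₁ (cmPlacesEquiv L b)) (m₁ m₂ : InfinitePlace L → ℤ)

/-- **ALL compact letters on an inserted printed pure tensor, KERNEL FORM.** -/
theorem cmPairRepTwist_letterSection_ins_tprod
    (h : ∀ v : {v : InfinitePlace ↥(maximalRealSubfield L) // v.IsReal},
      DPK (PosIdx (cmXV L dV hdV ι₁ v)) (NegIdx (cmXV L dV hdV ι₁ v)) (PosIdx (cmXW L dV dW hdW ι₁ v)) (NegIdx (cmXW L dV dW hdW ι₁ v)))
    (f : FinSB ↥(maximalRealSubfield L) (Fin 6))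
    (m : ∀ b : InfinitePlace L, ((printPlaces (InfinitePlace L) (kindOf L dV hdV dW hdW ι₁ datum)
      (lamOf L dV hdV dW hdW ι₁ datum) (lamOf_ne_zero L dV hdV dW hdW ι₁ datum)
      (pinnedVacs (kindOf L dV hdV dW hdW ι₁ datum) m₁ m₂)).loc b).M) :
    cmPairRepTwist L finProdFinEquiv dV hdV hdV0 dW hdW hdW0 hGR η
        (archProdHom (↥(maximalRealSubfield L)) L (IsCMField.complexConj L) 3 2 (Matrix.diagonal dV) (Matrix.diagonal dW)
          (letterSection L dV hdV hdV0 dW hdW hdW0 ι₁ h))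
        (ins L dV hdV hdV0 dW hdW hdW0 ι₁ datum m₁ m₂ f (PiTensorProduct.tprod ℂ m)) =
      (((η (archProdHom (↥(maximalRealSubfield L)) L (IsCMField.complexConj L) 3 2 (Matrix.diagonal dV) (Matrix.diagonal dW)
          (letterSection L dV hdV hdV0 dW hdW hdW0 ι₁ h)) : ℂˣ) : ℂ) *
          ((letterChar L dV hdV hdV0 dW hdW hdW0 hGR ι₁ h₁V h₁W hV hW h : Circle) : ℂ)) •
        piSchwartzBruhatEquiv ↥(maximalRealSubfield L) (Fin 6)
          (follandFock (cmBigFrame L finProdFinEquiv dV hdV hdV0 dW hdW hdW0 ι₁)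
            (∏ w, rename (atPlace w)
              (linSubst (star ((reindexUnitary (pairFrame (PosIdx (cmXV L dV hdV ι₁ w)) (NegIdx (cmXV L dV hdV ι₁ w))
                  (PosIdx (cmXW L dV dW hdW ι₁ w)) (NegIdx (cmXW L dV dW hdW ι₁ w)) finProdFinEquiv (cmEpsV L dV hdV ι₁ w)
                  (cmEpsW L dV dW hdW ι₁ w)) (dualPairι (h w)) :
                    Matrix.unitaryGroup (Fin 6) ℂ) : Matrix (Fin 6) (Fin 6) ℂ))
                (placePoly L dV hdV dW hdW ι₁ datum m₁ m₂ m w))) ⊗ₜ f) := by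
  rw [ins_tprod, cmPairRepTwist_archProdHom_tmul, cmArchWeilRep_letterSection_follandFock,
    linSubst_star_placeBlock_prod_rename_atPlace, ← TensorProduct.smul_tmul', map_smul, smul_smul]

/-- **eigen-place-polynomials ⇒ the inserted pure tensor is an eigenvector of all the letters at once**, eigenvalue
`η(letterSection h) · letterChar h · ∏_w d w`. -/
theorem cmPairRepTwist_letterSection_ins_tprod_of_eigen
    (h : ∀ v : {v : InfinitePlace ↥(maximalRealSubfield L) // v.IsReal},
      DPK (PosIdx (cmXV L dV hdV ι₁ v)) (NegIdx (cmXV L dV hdV ι₁ v)) (PosIdx (cmXW L dV dW hdW ι₁ v)) (NegIdx (cmXW L dV dW hdW ι₁ v)))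
    (f : FinSB ↥(maximalRealSubfield L) (Fin 6))
    (m : ∀ b : InfinitePlace L, ((printPlaces (InfinitePlace L) (kindOf L dV hdV dW hdW ι₁ datum)
      (lamOf L dV hdV dW hdW ι₁ datum) (lamOf_ne_zero L dV hdV dW hdW ι₁ datum)
      (pinnedVacs (kindOf L dV hdV dW hdW ι₁ datum) m₁ m₂)).loc b).M)
    (d : {v : InfinitePlace ↥(maximalRealSubfield L) // v.IsReal} → ℂ)
    (hd : ∀ w, linSubst (star ((reindexUnitary (pairFrame (PosIdx (cmXV L dV hdV ι₁ w)) (NegIdx (cmXV L dV hdV ι₁ w))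
        (PosIdx (cmXW L dV dW hdW ι₁ w)) (NegIdx (cmXW L dV dW hdW ι₁ w)) finProdFinEquiv (cmEpsV L dV hdV ι₁ w)
        (cmEpsW L dV dW hdW ι₁ w)) (dualPairι (h w)) :
          Matrix.unitaryGroup (Fin 6) ℂ) : Matrix (Fin 6) (Fin 6) ℂ)) (placePoly L dV hdV dW hdW ι₁ datum m₁ m₂ m w) =
      d w • placePoly L dV hdV dW hdW ι₁ datum m₁ m₂ m w) :
    cmPairRepTwist L finProdFinEquiv dV hdV hdV0 dW hdW hdW0 hGR η
        (archProdHom (↥(maximalRealSubfield L)) L (IsCMField.complexConj L) 3 2 (Matrix.diagonal dV) (Matrix.diagonal dW)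
          (letterSection L dV hdV hdV0 dW hdW hdW0 ι₁ h))
        (ins L dV hdV hdV0 dW hdW hdW0 ι₁ datum m₁ m₂ f (PiTensorProduct.tprod ℂ m)) =
      (((η (archProdHom (↥(maximalRealSubfield L)) L (IsCMField.complexConj L) 3 2 (Matrix.diagonal dV) (Matrix.diagonal dW)
          (letterSection L dV hdV hdV0 dW hdW hdW0 ι₁ h)) : ℂˣ) : ℂ) *
          ((letterChar L dV hdV hdV0 dW hdW hdW0 hGR ι₁ h₁V h₁W hV hW h : Circle) : ℂ) * ∏ w, d w) •
        ins L dV hdV hdV0 dW hdW hdW0 ι₁ datum m₁ m₂ f (PiTensorProduct.tprod ℂ m) := by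
  rw [cmPairRepTwist_letterSection_ins_tprod L dV hdV hdV0 dW hdW hdW0 hGR ι₁ h₁V h₁W hV hW η datum m₁ m₂ h f m, ins_tprod]
  have hprod : (∏ w, rename (atPlace w)
      (linSubst (star ((reindexUnitary (pairFrame (PosIdx (cmXV L dV hdV ι₁ w)) (NegIdx (cmXV L dV hdV ι₁ w))
        (PosIdx (cmXW L dV dW hdW ι₁ w)) (NegIdx (cmXW L dV dW hdW ι₁ w)) finProdFinEquiv (cmEpsV L dV hdV ι₁ w)
        (cmEpsW L dV dW hdW ι₁ w)) (dualPairι (h w)) :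
          Matrix.unitaryGroup (Fin 6) ℂ) : Matrix (Fin 6) (Fin 6) ℂ)) (placePoly L dV hdV dW hdW ι₁ datum m₁ m₂ m w))) =
      (∏ w, d w) • ∏ w, rename (atPlace w) (placePoly L dV hdV dW hdW ι₁ datum m₁ m₂ m w) := by
    rw [smul_eq_C_mul, map_prod C, ← Finset.prod_mul_distrib]
    refine Finset.prod_congr rfl fun w _ => ?_
    rw [hd w, smul_eq_C_mul, map_mul, rename_C]
  rw [hprod, follandFock_smul, ← TensorProduct.smul_tmul', map_smul, smul_smul]

end Letters

end HodgeCM.Model.HypCensus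

end
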